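import Mathlib
import Summits.KontsevichZagierPeriods.Zeta5Search.ClusterValuationPairs
import Summits.KontsevichZagierPeriods.Zeta5Search.ZeroEvaluationProof
import HarnessLib

/-!
# ζ(5) search — the `𝒦`-piece bounds and the `ν`-bound of the class valuation theory are THEOREMS

Cell `pub-zeta5` (HONEST FRAMING: systematic search; no irrationality claim unless certified), typer seat
generation 8.  Discharges BY NAME three statements of gen-2 g8's addendum `Zeta5Search/ClusterValuationPairs.lean` — the
termwise ingredients of THEOREM LB (`CasoratianClassBound`, REPORT-gen2-g8 §3.7):

* `singlePoleClassKBound_holds : SinglePoleClassKBound` — `v_p(𝒦_x) ≥ 1` for a single-pole class (Theorem A′ and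
  `p ∣ g_o(q+1) − [o=2]`);
* `multipoleClassKBound_holds : MultipoleClassKBound` — `v_p(𝒦_x) ≥ 3 + E_x` for every pole class (Theorem A, and
  `p² ∣ g_0`);
* `classNuBound_holds : ClassNuBound` — `v_p(V_x) ≥ ν_x` (`ClassVBound`, and `ZeroEvaluation` for the tame single-pole
  classes; a pole at level `0` has no class point below it).

The arithmetic input is the congruence `(t^p − t)² ≡ ((t+k)^p − (t+k))² (mod p)` (Frobenius + Fermat in `(ZMod p)[X]`), which
gives `p ∣ g_o(k) − [o=2]` for `o ≤ 5 < p+1` (`taylorTT_sub_dvd`), and `g_0(k) = ((−k)^p + k)²` (`taylorTT_zero_dvd_sq`).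
Identities of rational numbers; nothing about irrationality.
-/

noncomputable section

open Finset

namespace Summit.KontsevichZagierPeriods.Zeta5Search.ClusterValuation

open Summit.KontsevichZagierPeriods.Zeta5Search.WedgeDictionary (pfData)
open Summit.KontsevichZagierPeriods.Zeta5Search.CasoratianValuation (InPolytope)
open Summit.KontsevichZagierPeriods.Zeta5Search.PadicSeries

/-! ### The congruences for the Taylor coefficients `g_o(k)` of `(t^p − t)²` -/

section Congruence

open Polynomial

/-- `g_o(k)` is the `o`-th coefficient of `(X − k)^{2p} − 2(X − k)^{p+1} + (X − k)²`. -/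
theorem taylorTT_eq_coeff (p o : ℕ) (k : ℤ) :
    taylorTT p o k =
      ((X + C (-k)) ^ (2 * p) - C 2 * (X + C (-k)) ^ (p + 1) + (X + C (-k)) ^ 2 : ℤ[X]).coeff o := by
  rw [coeff_add, coeff_sub, coeff_C_mul, coeff_X_add_C_pow, coeff_X_add_C_pow, coeff_X_add_C_pow, taylorTT]
  ring

/-- In characteristic `p`: `(X − k)^{2p} − 2(X − k)^{p+1} + (X − k)² = (X^p − X)²`. -/
theorem frobenius_square (p : ℕ) [hp : Fact p.Prime] (a : ZMod p) :
    ((X + C a) ^ (2 * p) - C 2 * (X + C a) ^ (p + 1) + (X + C a) ^ 2 : (ZMod p)[X]) = (X ^ p - X) ^ 2 := by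
  have hfrob : ((X + C a) ^ p : (ZMod p)[X]) = X ^ p + C a := by
    rw [add_pow_char, ← C_pow, ZMod.pow_card]
  rw [pow_succ (X + C a : (ZMod p)[X]) p, show 2 * p = p * 2 by ring, pow_mul, hfrob,
    show (C 2 : (ZMod p)[X]) = 2 from map_ofNat C 2]
  ring

/-- **`p ∣ g_o(k) − [o = 2]`** for `o ≤ 5` and a prime `p ≥ 5`. -/
theorem taylorTT_sub_dvd {p : ℕ} (hp : p.Prime) (h5 : 5 ≤ p) {o : ℕ} (ho : o < 6) (k : ℤ) :
    (p : ℤ) ∣ taylorTT p o k - (if o = 2 then 1 else 0) := by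
  haveI := Fact.mk hp
  have hc : ((taylorTT p o k : ℤ) : ZMod p) =
      (((X + C (-k)) ^ (2 * p) - C 2 * (X + C (-k)) ^ (p + 1) + (X + C (-k)) ^ 2 : ℤ[X]).map
        (Int.castRingHom (ZMod p))).coeff o := by
    rw [Polynomial.coeff_map, ← taylorTT_eq_coeff, eq_intCast]
  have hmap : (((X + C (-k)) ^ (2 * p) - C 2 * (X + C (-k)) ^ (p + 1) + (X + C (-k)) ^ 2 : ℤ[X]).map
      (Int.castRingHom (ZMod p))) =
      (X + C ((-k : ℤ) : ZMod p)) ^ (2 * p) - C 2 * (X + C ((-k : ℤ) : ZMod p)) ^ (p + 1)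
        + (X + C ((-k : ℤ) : ZMod p)) ^ 2 := by
    simp only [Polynomial.map_add, Polynomial.map_sub, Polynomial.map_mul, Polynomial.map_pow, Polynomial.map_C,
      Polynomial.map_X, Int.coe_castRingHom, Int.cast_ofNat]
  have hsq : ((X : (ZMod p)[X]) ^ p - X) ^ 2 = X ^ (2 * p) - C 2 * X ^ (p + 1) + X ^ 2 := by
    rw [show (C 2 : (ZMod p)[X]) = 2 from map_ofNat C 2]; ring
  rw [← ZMod.intCast_zmod_eq_zero_iff_dvd, Int.cast_sub, hc, hmap, frobenius_square, hsq,
    coeff_add, coeff_sub, coeff_C_mul, coeff_X_pow, coeff_X_pow, coeff_X_pow, if_neg (by omega), if_neg (by omega)]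
  split_ifs <;> simp

/-- **`p² ∣ g_0(k)`**: `g_0(k) = ((−k)^p − (−k))²`. -/
theorem taylorTT_zero_dvd_sq {p : ℕ} (hp : p.Prime) (k : ℤ) : (p : ℤ) ^ 2 ∣ taylorTT p 0 k := by
  haveI := Fact.mk hp
  have h : taylorTT p 0 k = ((-k) ^ p - (-k)) ^ 2 := by
    rw [taylorTT]
    simp only [Nat.choose_zero_right, Nat.cast_one, one_mul, Nat.sub_zero, mul_one]
    generalize -k = a
    ring
  rw [h]
  refine pow_dvd_pow_of_dvd ?_ 2
  rw [← ZMod.intCast_zmod_eq_zero_iff_dvd]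
  push_cast
  rw [ZMod.pow_card, sub_self]

end Congruence

/-! ### Norm bounds for the `𝒦`-weights -/

variable {p : ℕ} [hp : Fact p.Prime]

/-- `‖g_o(k) − [o=2]‖_p ≤ p^{−1}` (`o ≤ 5`, `p ≥ 5`). -/
theorem padicNorm_taylorTT_sub_le (h5 : 5 ≤ p) {o : ℕ} (ho : o < 6) (k : ℤ) :
    padicNorm p ((taylorTT p o k : ℚ) - if o = 2 then 1 else 0) ≤ (p : ℚ) ^ (-(1 : ℤ)) := by
  have h := taylorTT_sub_dvd hp.out h5 ho k
  have hcast : ((taylorTT p o k : ℚ) - if o = 2 then 1 else 0) =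
      (((taylorTT p o k - (if o = 2 then 1 else 0) : ℤ)) : ℚ) := by
    push_cast; split_ifs <;> simp
  rw [hcast]
  have := padicNorm.dvd_iff_norm_le.1 (show ((p ^ 1 : ℕ) : ℤ) ∣ taylorTT p o k - (if o = 2 then 1 else 0) by simpa using h)
  simpa using this

/-- `‖g_0(k)‖_p ≤ p^{−2}`. -/
theorem padicNorm_taylorTT_zero_le (k : ℤ) : padicNorm p ((taylorTT p 0 k : ℚ)) ≤ (p : ℚ) ^ (-(2 : ℤ)) := by
  have := padicNorm.dvd_iff_norm_le.1 (show ((p ^ 2 : ℕ) : ℤ) ∣ taylorTT p 0 k by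
    simpa using taylorTT_zero_dvd_sq hp.out k)
  simpa using this

/-- Combined weight bound: `‖g_o(k) − [o=2]‖_p ≤ p^{−1}`, and `≤ p^{−2}` for `o = 0`; stated as `≤ p^{−(2 − min o 1)}`. -/
theorem padicNorm_weight_le (h5 : 5 ≤ p) {o : ℕ} (ho : o < 6) (k : ℤ) :
    padicNorm p ((taylorTT p o k : ℚ) - if o = 2 then 1 else 0) ≤ (p : ℚ) ^ (-(2 - (min o 1 : ℕ) : ℤ)) := by
  rcases Nat.eq_zero_or_pos o with rfl | hpos
  · simpa using padicNorm_taylorTT_zero_le (p := p) k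
  · rw [show (min o 1 : ℕ) = 1 by omega]
    simpa using padicNorm_taylorTT_sub_le (p := p) h5 ho k

/-! ### The `𝒦`-pieces -/

/-- **`SinglePoleClassKBound` is a theorem**: `v_p(𝒦_x) ≥ 1` for a class with exactly one pole. -/
theorem singlePoleClassKBound_holds : SinglePoleClassKBound := by
  intro b p x hb hprime hp5 hwin _hx hcount hne
  haveI : Fact p.Prime := ⟨hprime⟩
  obtain ⟨_, -, -, _⟩ := thmA_data b hb hwin
  have hK : padicNorm p (classK b p x) ≤ (p : ℚ) ^ (-(1 : ℤ)) := by
    unfold classK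
    refine padicNorm.sum_le' (fun q hq => padicNorm.sum_le' (fun o ho => ?_) (zpow_p_nonneg _)) (zpow_p_nonneg _)
    have ho' := mem_range.1 ho
    have hqn : q ≤ (b 0).toNat := ((mem_classSet_iff b x q).1 hq).1
    rw [padicNorm.mul]
    -- `‖c_{o,q}‖ ≤ 1`: zero at a non-pole, Theorem A′ at the pole
    have hc : padicNorm p (pfData b o q) ≤ 1 := by
      by_cases h0 : pfData b o q = 0
      · rw [h0, padicNorm.zero]; exact zero_le_one
      · have hcq : classPoleCount b p q = 1 := by
          unfold classPoleCount; rw [classSet_eq_of_mem hq]; exact hcount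
        have hv := isolatedPoleIntegral_holds b p q o hb hprime (by omega) hwin hqn ho' h0 hcq
        rw [padicNorm.eq_zpow_of_nonzero h0]
        exact zpow_le_one_of_nonpos₀ one_le_p (by linarith)
    calc padicNorm p (pfData b o q) * padicNorm p ((taylorTT p o ((q : ℤ) + 1) : ℚ) - if o = 2 then 1 else 0)
        ≤ 1 * (p : ℚ) ^ (-(1 : ℤ)) :=
          mul_le_mul hc (padicNorm_taylorTT_sub_le hp5 ho' _) (padicNorm.nonneg _) zero_le_one
      _ = (p : ℚ) ^ (-(1 : ℤ)) := one_mul _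
  rw [padicNorm.eq_zpow_of_nonzero hne, zpow_le_zpow_iff_right₀ one_lt_p] at hK
  linarith

/-- **`MultipoleClassKBound` is a theorem**: `v_p(𝒦_x) ≥ 3 + E_x` for every class with a pole (in fact for every class
with `𝒦_x ≠ 0`). -/
theorem multipoleClassKBound_holds : MultipoleClassKBound := by
  intro b p x hb hprime hp5 hwin _hx _hpole hne
  haveI : Fact p.Prime := ⟨hprime⟩
  have hK : padicNorm p (classK b p x) ≤ (p : ℚ) ^ (-(3 + classExp b p x)) := by
    unfold classK
    refine padicNorm.sum_le' (fun q hq => padicNorm.sum_le' (fun o ho => ?_) (zpow_p_nonneg _)) (zpow_p_nonneg _)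
    have ho' := mem_range.1 ho
    have hqn : q ≤ (b 0).toNat := ((mem_classSet_iff b x q).1 hq).1
    rw [padicNorm.mul]
    by_cases h0 : pfData b o q = 0
    · rw [h0, padicNorm.zero, zero_mul]; exact zpow_p_nonneg _
    · have hA := clusterBound_holds b p q o hb hprime (by omega) hwin hqn ho' h0
      rw [classExp_eq_of_mem hq] at hA
      have hcn : padicNorm p (pfData b o q) ≤ (p : ℚ) ^ (-((o : ℤ) + 1 + classExp b p x)) := by
        rw [padicNorm.eq_zpow_of_nonzero h0]
        exact zpow_le_zpow_right₀ one_le_p (by linarith)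
      have hw := padicNorm_weight_le (p := p) hp5 ho' ((q : ℤ) + 1)
      calc padicNorm p (pfData b o q) * padicNorm p ((taylorTT p o ((q : ℤ) + 1) : ℚ) - if o = 2 then 1 else 0)
          ≤ (p : ℚ) ^ (-((o : ℤ) + 1 + classExp b p x)) * (p : ℚ) ^ (-(2 - (min o 1 : ℕ) : ℤ)) :=
            mul_le_mul hcn hw (padicNorm.nonneg _) (zpow_p_nonneg _)
        _ ≤ (p : ℚ) ^ (-(3 + classExp b p x)) := by
            rw [← zpow_add₀ (Nat.cast_ne_zero.2 hprime.ne_zero)]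
            refine zpow_le_zpow_right₀ one_le_p ?_
            have : ((min o 1 : ℕ) : ℤ) ≤ o := by push_cast; exact min_le_left _ _
            push_cast at this ⊢
            omega
  rw [padicNorm.eq_zpow_of_nonzero hne, zpow_le_zpow_iff_right₀ one_lt_p] at hK
  linarith

/-! ### The `ν`-bound -/

omit hp in
/-- Unfolding the Boolean tameness test. -/
theorem tameSingle_iff (b : ℕ → ℤ) (p x : ℕ) :
    tameSingle b p x = true ↔
      ∃ q ∈ classSet b p x, netExp b q < 0 ∧ (q < p ∨ ∀ s ∈ classSet b p x, s < q → 0 < netExp b s) := by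
  unfold tameSingle
  rw [decide_eq_true_iff]

/-- **`ClassNuBound` is a theorem**: `v_p(V_x) ≥ ν_x` for every pole class. -/
theorem classNuBound_holds : ClassNuBound := by
  intro b p x hb hprime hp5 hwin hx hpole hne
  haveI : Fact p.Prime := ⟨hprime⟩
  have hE := classVBound_holds b p x hb hprime hp5 hwin hx hpole hne
  unfold classNu
  split_ifs with h
  · obtain ⟨hcount, htame⟩ := h
    obtain ⟨q, hq, hqpole, hor⟩ := (tameSingle_iff b p x).1 htame
    refine max_le hE ?_
    refine zeroEvaluation_holds b p x q hb hprime hp5 hwin hx hcount hq hqpole ?_ hne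
    intro s hs hsq
    rcases hor with hqp | hall
    · -- a pole at level 0 has no class point below it
      exfalso
      have hsx : s % p = x % p := (mem_filter.1 hs).2
      have hqx : q % p = x % p := (mem_filter.1 hq).2
      have : s = q := by
        rw [← Nat.mod_eq_of_lt (lt_trans hsq hqp), ← Nat.mod_eq_of_lt hqp, hsx, hqx]
      omega
    · exact (hall s hs hsq).ne'
  · exact hE

end Summit.KontsevichZagierPeriods.Zeta5Search.ClusterValuation

end
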